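import Literature.MathematicalPhysics.QuantumFieldTheory.Balaban1983to89.B4TorusGreen244

/-!
# `Balaban1983to89.B4TorusPositivity` — the quadratic form of `−Δ^ξ + m² + aQ^*Q` ON THE TORUS ((1.3), (1.5), the
# "quadratic form considerations" (2.26)–(2.28) of B4): energy identity, injectivity, invertibility, and UNIQUENESS of
# the torus Green kernel `K_T` of `B4TorusGreen244`

T. Bałaban, *Regularity and decay of lattice Green's functions*, Commun. Math. Phys. **89**, 571–597 (1983)
[Balaban1983RegularityDecay] (cell paper B4): p. 572 [PDF 2] ((1.3)–(1.6), the torus), p. 580 [PDF 10] ((2.26)–(2.28)),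
p. 584 [PDF 14] (2.44).  Renders `1983-cmp89-regularity-decay-p002/p010/p014-x2.png` read as images by this seat.

CITATION HEADER (lean-in-tree rule 2026-08-18).  This module is a SUPPLEMENT, not a quotation.  PRINTED: p. 572, verbatim:
*"Now the covariant Laplace operator −Δ^{η,N}_{A,Ω} on a domain Ω with Neumann boundary conditions on ∂Ω is given by the
following quadratic form defined on functions φ : Ω → R^N  ⟨φ,(−Δ^{η,N}_{A,Ω})φ⟩ = Σ_{b⊂Ω} η^d|(D^η_Aφ)(b)|² =
Σ_{b⊂Ω} η^d|η^{−1}(U(A_b)φ(b_+) − φ(b_−))|², (1.3) where the summation is over the set of all bonds b = ⟨b_−,b_+⟩ with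
end-points b_−, b_+ in Ω."*; (1.4) *"(Q_k(A)φ)(y) = Σ_{x∈B^k(y)} η^d U(A(Γ^{(k)}_{y,x}))φ(x), y ∈ Z^d"*; (1.5) *"The projection
operator P_k(A) is given by P_k(A) = Q_k^*(A)Q_k(A)."*; (1.6) *"Our fundamental Green's function is a kernel of the operator
G_k(Ω,A) = (−Δ^{η,N}_{A,Ω} + m² + aP_k(A))^{−1}, where m² ≥ 0 and a is a positive constant close to 1."*; and the torus
sentence *"Another common case is to consider operators on subsets of a torus T_η which we identify with a rectangular
parallelepiped in ηZ^d with periodic conditions."*  P. 580, verbatim: *"Now these bounds are consequences of quadratic form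
considerations. … The operator −Δ^{η,N}_Δ is bounded from below by π² on a subspace of functions on Δ orthogonal to
constant functions, which are its eigenvectors corresponding to eigenvalue 0. The operator P_k is an orthogonal projection
on a subspace of constant functions, thus ⟨φ,(−Δ^{η,N}_Δ + a_kP_k)φ⟩ ≥ min{π², a_k}‖φ‖_{L²(Δ)}, (2.27) and from this and
(2.26) we get 0 < G_k(□,0) ≤ c₀I"* (2.28).  The existence of the inverse (1.6) is ASSERTED by the notation `(…)^{−1}`;
the paper's argument for it is the positivity of the quadratic form ((1.3) ≥ 0, P_k ≥ 0 a projection, a > 0, m² ≥ 0, and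
−Δ + aP_k > 0 because the only functions annihilated by both are constants with vanishing block averages).  This module
TYPES that argument ON THE TORUS, for the stencil `D = B4Green244.opD` (A = 0, ξ-units), qualitatively (no constant
`min{π², a_k}` — which is false as printed anyway, cell census G-B4-03, `B4.Display227Repaired`).

WHAT THE CELL ALREADY HAS (imported, untouched): `B4TorusGreen244.torusGreen244` (this seat, p180219): the finite
dual-grid kernel `KT n a m2 N z y` of (2.48) is A `(nN_μ)_μ`-periodic solution of (2.44) on the torus with `f = Q^*δ^T_y`;
`B4TorusGreen244.opD_translate`: `D` preserves `(nN_μ)_μ`-periodicity.  Its HONEST SCOPE (ii) left open that `K_T(·,y)` is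
THE solution.  THIS FILE (journal node G-B4-02b-TORUSPOSITIVITY-KERNEL of the cell `pub-balaban`) closes it:
* §1 `box P` (one period cell `Π_μ [0,P_μ) ⊂ ℤ^{d+1}`), `IsPeriodic P φ`, `wrap P z = z mod P ∈ box P`; §2 THE DISCRETE
  TORUS HAS NO BOUNDARY: `IsPeriodic.sum_box_add` — `Σ_{z∈box} φ(z + v) = Σ_{z∈box} φ(z)` for periodic `φ` (re-indexing by
  the bijection `z ↦ (z + v) mod P` of the box); `sum_box_fine` — a period box of the fine torus (period `nN`) is the
  disjoint union of the blocks over the unit box (period `N`): `Σ_{z∈box(nN)} H(z) = Σ_{x∈box N} Σ_{j∈[0,n)^{d+1}} H(nx + j)`;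
* §3 **`energy_identity`** — for `(nN_μ)_μ`-periodic `φ` (complex valued; the paper's `φ` is `R^N`-valued, each component
  is covered):  `Σ_{z∈box(nN)} conj φ(z) · (Dφ)(z) = n² Σ_{z∈box(nN)} Σ_μ ‖φ(z+e_μ) − φ(z)‖² + m² Σ_{z∈box(nN)} ‖φ(z)‖²
  + a n^{−(d+1)} Σ_{x∈box N} ‖Σ_{j} φ(nx+j)‖²` — i.e. `⟨φ, Dφ⟩_T = ‖∇^ξφ‖²_T + m²‖φ‖²_T + a‖Q φ‖²` ((1.3) with A = 0 on
  the torus: every bond counted once, periodic summation by parts; (1.5): `⟨φ, Q^*Qφ⟩ = ‖Qφ‖²`), up to the overall volume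
  weight `ξ^{d+1}` of the paper's scalar products;
* §4 **`opD_torus_injective`** — `a > 0`, `m² ≥ 0`: a periodic `φ` with `Dφ = 0` vanishes (gradient term zero ⇒ `φ`
  shift-invariant ⇒ constant (`constant_of_shift_invariant`); block term zero ⇒ the constant is `0`) — the torus form of
  "`0 < G_k`" in (2.28); **`torusGreen244_unique`** — every `(nN_μ)_μ`-periodic solution `ψ` of
  `Dψ = 1[⌊·/n⌋ ≡ y mod N]` IS `KT(·,y)`: the kernel of `B4TorusGreen244` / `B4Torus248Decay` is THE kernel of `G_jQ_j^*` on
  the torus;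
* §5 **`opDBox_bijective`** / **`torusGreen_existsUnique`** — read in coordinates on one period box `Π_μ [0,nN_μ)`
  (periodic extension `pext`, `opDBox`), `D` is a `ℂ`-linear endomorphism of the finite-dimensional space
  `box(nN) → ℂ`, injective by §4, hence bijective: for every `(nN_μ)_μ`-periodic `f` there is exactly one
  `(nN_μ)_μ`-periodic `φ` with `Dφ = f` — the Green operator `G_j = D⁻¹` of (1.6) (A = 0) EXISTS on the torus
  `T_ξ = Π_μ ℤ/(nN_μ)`, for every `n ≥ 1`, `a > 0`, `m² ≥ 0` (including `m = 0`: the zero mode of the torus Laplacian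
  is removed by `aQ^*Q`).

DICTIONARY / HONEST SCOPE.  ξ-units as in `B4Green244` (`n = L^j = ξ⁻¹`, fine point `z ∈ ℤ^{d+1}`, `A = 0`); the torus is
`Π_μ ℤ/(nN_μ)` — `N_μ ≥ 1` unit blocks of side `n` per direction, functions on it = `(nN_μ)_μ`-periodic functions on
`ℤ^{d+1}`, the operator on it = the stencil `opD` on such functions (`B4TorusGreen244.opD_translate`); scalar products
without the volume weight `ξ^{d+1}`.  NOT typed: the quantitative lower bound (2.27)/(2.28) (`min{π²,a_k}`; see census
G-B4-03), Neumann boxes `□` (B4's own setting for (2.26)–(2.29); reflections, pv17 `B4Reflection242`), covariant `A ≠ 0`,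
the `η`-rescaling.  Value = kernel certificate of a located by-reference step (existence AND uniqueness of the torus Green
operator (1.6) with A = 0, and the identification of the (2.48) torus kernel with `G_jQ_j^*`), NOT summit progress.  Unit
b2b-balaban-b04-g5 (paper sub-cell B04 gen 5); staged byte-identically under `HOME/lean/BalabanYm4/`.
-/

namespace Literature.MathematicalPhysics.QuantumFieldTheory.Balaban1983to89.B4TorusPositivity

open Complex Finset ComplexConjugate
open Literature.MathematicalPhysics.QuantumFieldTheory.Balaban1983to89.B4Strip
open Literature.MathematicalPhysics.QuantumFieldTheory.Balaban1983to89.B4StripSums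
open Literature.MathematicalPhysics.QuantumFieldTheory.Balaban1983to89.B4TorusKernel
open Literature.MathematicalPhysics.QuantumFieldTheory.Balaban1983to89.B4Torus248Decay
open Literature.MathematicalPhysics.QuantumFieldTheory.Balaban1983to89.B4Green244
open Literature.MathematicalPhysics.QuantumFieldTheory.Balaban1983to89.B4TorusGreen244
open scoped Real

noncomputable section

variable {d : ℕ}

/-! ### §1 The period box, periodic functions, reduction modulo the period -/

/-- one period cell `Π_μ [0, P_μ) ⊂ ℤ^{d+1}` (a fundamental domain of the torus `Π_μ ℤ/P_μ`). [folklore] -/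
def box (P : Fin (d + 1) → ℕ) : Finset (Fin (d + 1) → ℤ) :=
  Fintype.piFinset fun i => Finset.Ico (0 : ℤ) (P i)

/-- membership in the period box, coordinatewise. [folklore] -/
theorem mem_box {P : Fin (d + 1) → ℕ} {z : Fin (d + 1) → ℤ} : z ∈ box P ↔ ∀ i, 0 ≤ z i ∧ z i < P i := by
  simp only [box, Fintype.mem_piFinset, Finset.mem_Ico]

/-- the fine period `nN_μ ≥ 1`. [folklore] -/
theorem period_pos (n : ℕ) [NeZero n] {N : Fin (d + 1) → ℕ} (hN : ∀ i, 1 ≤ N i) : ∀ i, 1 ≤ n * N i := fun i =>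
  Nat.one_le_iff_ne_zero.mpr (Nat.mul_ne_zero (NeZero.ne n) (by have := hN i; omega))

/-- `(P_μ)_μ`-periodicity of a function on `ℤ^{d+1}` (= a function on the torus `Π_μ ℤ/P_μ`).
[cite: Balaban1983RegularityDecay, p.572 (the torus T_η "with periodic conditions"); dictionary] [folklore] -/
def IsPeriodic (P : Fin (d + 1) → ℕ) (φ : (Fin (d + 1) → ℤ) → ℂ) : Prop :=
  ∀ z m, φ (MultiPeriod.translate P z m) = φ z

/-- reduction modulo the period: `wrap P z = (z_μ mod P_μ)_μ`. [folklore] -/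
def wrap (P : Fin (d + 1) → ℕ) (z : Fin (d + 1) → ℤ) : Fin (d + 1) → ℤ := fun i => z i % (P i : ℤ)

/-- `z mod P` lies in the period box. [folklore] -/
theorem wrap_mem_box {P : Fin (d + 1) → ℕ} (hP : ∀ i, 1 ≤ P i) (z : Fin (d + 1) → ℤ) : wrap P z ∈ box P :=
  mem_box.mpr fun i => by
    have h : (0 : ℤ) < P i := by exact_mod_cast hP i
    exact ⟨Int.emod_nonneg _ h.ne', Int.emod_lt_of_pos _ h⟩

/-- `z mod P = z − P⌊z/P⌋` is a translate of `z` by the period lattice. [folklore] -/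
theorem wrap_eq_translate (P : Fin (d + 1) → ℕ) (z : Fin (d + 1) → ℤ) :
    wrap P z = MultiPeriod.translate P z (fun i => -(z i / P i)) := by
  funext i
  rw [MultiPeriod.translate_apply]
  show z i % (P i : ℤ) = z i + P i * -(z i / P i)
  linarith [Int.mul_ediv_add_emod (z i) (P i)]

/-- points of the box are their own reductions. [folklore] -/
theorem wrap_eq_self_of_mem {P : Fin (d + 1) → ℕ} {z : Fin (d + 1) → ℤ} (hz : z ∈ box P) : wrap P z = z := by
  funext i
  exact Int.emod_eq_of_lt (mem_box.mp hz i).1 (mem_box.mp hz i).2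

/-- a periodic function takes the same value at `z` and at `z mod P`. [folklore] -/
theorem IsPeriodic.wrap_eq {P : Fin (d + 1) → ℕ} {φ : (Fin (d + 1) → ℤ) → ℂ} (hφ : IsPeriodic P φ)
    (z : Fin (d + 1) → ℤ) : φ (wrap P z) = φ z := by
  rw [wrap_eq_translate]
  exact hφ z _

/-- `((z mod P) + v) mod P = (z + v) mod P`. [folklore] -/
theorem wrap_wrap_add (P : Fin (d + 1) → ℕ) (z v : Fin (d + 1) → ℤ) : wrap P (wrap P z + v) = wrap P (z + v) := by
  funext i
  simp only [wrap, Pi.add_apply]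
  exact Int.emod_add_emod _ _ _

/-- translates commute with shifts: `(z + Pm) + v = (z + v) + Pm`. [folklore] -/
theorem translate_add_right (P : Fin (d + 1) → ℕ) (z m v : Fin (d + 1) → ℤ) :
    MultiPeriod.translate P z m + v = MultiPeriod.translate P (z + v) m := by
  funext i
  simp only [Pi.add_apply, MultiPeriod.translate_apply]
  ring

/-- `(z + Pm) − v = (z − v) + Pm`. [folklore] -/
theorem translate_sub_right (P : Fin (d + 1) → ℕ) (z m v : Fin (d + 1) → ℤ) :
    MultiPeriod.translate P z m - v = MultiPeriod.translate P (z - v) m := by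
  funext i
  simp only [Pi.sub_apply, MultiPeriod.translate_apply]
  ring

/-- shifts of periodic functions are periodic. [folklore] -/
theorem IsPeriodic.shift {P : Fin (d + 1) → ℕ} {φ : (Fin (d + 1) → ℤ) → ℂ} (hφ : IsPeriodic P φ)
    (v : Fin (d + 1) → ℤ) : IsPeriodic P (fun w => φ (w + v)) := fun z m => by
  show φ (MultiPeriod.translate P z m + v) = φ (z + v)
  rw [translate_add_right]
  exact hφ _ _

/-! ### §2 The discrete torus has no boundary: box sums are shift invariant; a fine period box is a union of blocks -/

/-- **PERIODIC SUMMATION IS SHIFT INVARIANT**: `Σ_{z ∈ box P} φ(z + v) = Σ_{z ∈ box P} φ(z)` for `P`-periodic `φ` and any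
`v ∈ ℤ^{d+1}` (re-index by the bijection `z ↦ (z + v) mod P` of the box, inverse `z ↦ (z − v) mod P`). [folklore] -/
theorem IsPeriodic.sum_box_add {P : Fin (d + 1) → ℕ} (hP : ∀ i, 1 ≤ P i) {φ : (Fin (d + 1) → ℤ) → ℂ}
    (hφ : IsPeriodic P φ) (v : Fin (d + 1) → ℤ) : ∑ z ∈ box P, φ (z + v) = ∑ z ∈ box P, φ z := by
  refine Finset.sum_nbij' (fun z => wrap P (z + v)) (fun z => wrap P (z - v)) (fun z _ => wrap_mem_box hP _)
    (fun z _ => wrap_mem_box hP _) (fun z hz => ?_) (fun z hz => ?_) (fun z _ => (hφ.wrap_eq (z + v)).symm)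
  · rw [sub_eq_add_neg, wrap_wrap_add, add_neg_cancel_right, wrap_eq_self_of_mem hz]
  · rw [wrap_wrap_add, sub_add_cancel, wrap_eq_self_of_mem hz]

/-- `(n x + j) mod n = j` for an offset `j ∈ [0,n)^{d+1}`. [folklore] -/
theorem offset_finePt (n : ℕ) [NeZero n] (x : Fin (d + 1) → ℤ) (j : Fin (d + 1) → Fin n) :
    offset n (finePt n x j) = j := by
  funext ν
  apply Fin.ext
  simp only [offset, finePt]
  rw [add_comm, Int.add_mul_emod_self_left, Int.emod_eq_of_lt (by positivity) (by exact_mod_cast (j ν).isLt)]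
  simp

/-- **A FINE PERIOD BOX IS THE UNION OF ITS BLOCKS**: with fine period `(nN_μ)_μ`, `Σ_{z ∈ box(nN)} H(z) =
Σ_{x ∈ box N} Σ_{j ∈ [0,n)^{d+1}} H(nx + j)` (the bijection `(x, j) ↦ nx + j`, inverse `z ↦ (⌊z/n⌋, z mod n)`). [folklore] -/
theorem sum_box_fine (n : ℕ) [NeZero n] (N : Fin (d + 1) → ℕ) (H : (Fin (d + 1) → ℤ) → ℂ) :
    ∑ z ∈ box (fun i => n * N i), H z = ∑ x ∈ box N, ∑ j : Fin (d + 1) → Fin n, H (finePt n x j) := by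
  have hn : (0 : ℤ) < n := by exact_mod_cast Nat.pos_of_ne_zero (NeZero.ne n)
  rw [← Finset.sum_product']
  symm
  refine Finset.sum_nbij' (fun p => finePt n p.1 p.2) (fun z => (coarse n z, offset n z)) (fun p hp => ?_)
    (fun z hz => ?_) (fun p _ => Prod.ext (coarse_finePt n p.1 p.2) (offset_finePt n p.1 p.2))
    (fun z _ => finePt_coarse_offset n z) (fun _ _ => rfl)
  · have hx := mem_box.mp (Finset.mem_product.mp hp).1
    refine mem_box.mpr fun i => ?_
    have h1 := hx i
    have hj : (((p.2 i : Fin n) : ℕ) : ℤ) < n := by exact_mod_cast (p.2 i).isLt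
    have hj0 : (0 : ℤ) ≤ (((p.2 i : Fin n) : ℕ) : ℤ) := by positivity
    have h2 : (n : ℤ) * (p.1 i + 1) ≤ (n : ℤ) * N i := mul_le_mul_of_nonneg_left (by omega) hn.le
    simp only [finePt, Nat.cast_mul]
    constructor
    · nlinarith [h1.1]
    · nlinarith
  · rw [Finset.mem_product]
    refine ⟨mem_box.mpr fun i => ?_, Finset.mem_univ _⟩
    have h := mem_box.mp hz i
    simp only [coarse]
    refine ⟨Int.ediv_nonneg h.1 hn.le, ?_⟩
    rw [Int.ediv_lt_iff_lt_mul hn]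
    have h2 := h.2
    push_cast at h2
    linarith [mul_comm (n : ℤ) (N i)]

/-! ### §3 The energy identity `⟨φ, Dφ⟩_T = ‖∇^ξφ‖² + m²‖φ‖² + a‖Qφ‖²` -/

/-- the gradient term, one direction: `Σ_{z∈box} conj φ(z)·(2φ(z) − φ(z+e_μ) − φ(z−e_μ)) = Σ_{z∈box} ‖φ(z+e_μ) − φ(z)‖²`
for periodic `φ` (periodic summation by parts: every bond of the torus counted once). [cite: Balaban1983RegularityDecay,
(1.3) p.572; dictionary (torus, A = 0)] [folklore] -/
theorem grad_term {P : Fin (d + 1) → ℕ} (hP : ∀ i, 1 ≤ P i) {φ : (Fin (d + 1) → ℤ) → ℂ} (hφ : IsPeriodic P φ)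
    (μ : Fin (d + 1)) :
    ∑ z ∈ box P, conj (φ z) * (2 * φ z - φ (z + e μ) - φ (z - e μ))
      = ∑ z ∈ box P, ((‖φ (z + e μ) - φ z‖ : ℝ) : ℂ) ^ 2 := by
  have h1 : ∑ z ∈ box P, conj (φ (z + e μ)) * φ (z + e μ) = ∑ z ∈ box P, conj (φ z) * φ z :=
    IsPeriodic.sum_box_add hP (φ := fun w => conj (φ w) * φ w) (fun z m => by simp only [hφ z m]) (e μ)
  have h2 : ∑ z ∈ box P, conj (φ (z + e μ)) * φ z = ∑ z ∈ box P, conj (φ z) * φ (z - e μ) := by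
    have hper : IsPeriodic P (fun w => conj (φ w) * φ (w - e μ)) := fun z m => by
      show conj (φ (MultiPeriod.translate P z m)) * φ (MultiPeriod.translate P z m - e μ) = conj (φ z) * φ (z - e μ)
      rw [translate_sub_right, hφ, hφ]
    have := IsPeriodic.sum_box_add hP hper (e μ)
    simpa only [add_sub_cancel_right] using this
  have h3 : ∀ z, ((‖φ (z + e μ) - φ z‖ : ℝ) : ℂ) ^ 2
      = conj (φ (z + e μ)) * φ (z + e μ) - conj (φ (z + e μ)) * φ z - conj (φ z) * φ (z + e μ)
        + conj (φ z) * φ z := by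
    intro z
    rw [← Complex.conj_mul', map_sub]
    ring
  simp_rw [h3, Finset.sum_add_distrib, Finset.sum_sub_distrib, h1, h2]
  rw [← Finset.sum_sub_distrib, ← Finset.sum_sub_distrib, ← Finset.sum_add_distrib]
  exact Finset.sum_congr rfl fun z _ => by ring

/-- **THE ENERGY IDENTITY ON THE TORUS** (the quadratic form (1.3) + (1.5) of the operator (1.6), A = 0, periodic
conditions): for every `(nN_μ)_μ`-periodic `φ : ℤ^{d+1} → ℂ`,
`Σ_{z∈box(nN)} conj φ(z)·(Dφ)(z) = n² Σ_{z∈box(nN)} Σ_μ ‖φ(z+e_μ) − φ(z)‖² + m² Σ_{z∈box(nN)} ‖φ(z)‖²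
 + a·n^{−(d+1)} Σ_{x∈box N} ‖Σ_{j∈[0,n)^{d+1}} φ(nx+j)‖²`, i.e. `⟨φ,(−Δ^ξ_T + m² + aQ^*Q)φ⟩ = ‖∇^ξφ‖² + m²‖φ‖² + a‖Qφ‖² ≥ 0`.
[cite: Balaban1983RegularityDecay, (1.3)–(1.6) p.572, (2.26)–(2.27) p.580 ("quadratic form considerations");
dictionary (torus, A = 0, no volume weight); proof supplied by the audit] -/
theorem energy_identity (n : ℕ) [NeZero n] (a m2 : ℝ) {N : Fin (d + 1) → ℕ} (hN : ∀ i, 1 ≤ N i)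
    (φ : (Fin (d + 1) → ℤ) → ℂ) (hφ : IsPeriodic (fun i => n * N i) φ) :
    ∑ z ∈ box (fun i => n * N i), conj (φ z) * opD n a m2 φ z
      = (((n : ℝ) ^ 2 * ∑ z ∈ box (fun i => n * N i), ∑ μ, ‖φ (z + e μ) - φ z‖ ^ 2
          + m2 * ∑ z ∈ box (fun i => n * N i), ‖φ z‖ ^ 2
          + a * ((n : ℝ) ^ (d + 1))⁻¹
              * ∑ x ∈ box N, ‖∑ j : Fin (d + 1) → Fin n, φ (finePt n x j)‖ ^ 2 : ℝ) : ℂ) := by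
  have hP := period_pos n hN
  -- the three parts
  have hgrad : ∑ z ∈ box (fun i => n * N i), conj (φ z) * ∑ μ, (2 * φ z - φ (z + e μ) - φ (z - e μ))
      = ∑ z ∈ box (fun i => n * N i), ∑ μ, ((‖φ (z + e μ) - φ z‖ : ℝ) : ℂ) ^ 2 := by
    calc ∑ z ∈ box (fun i => n * N i), conj (φ z) * ∑ μ, (2 * φ z - φ (z + e μ) - φ (z - e μ))
        = ∑ z ∈ box (fun i => n * N i), ∑ μ, conj (φ z) * (2 * φ z - φ (z + e μ) - φ (z - e μ)) :=
          Finset.sum_congr rfl fun z _ => by rw [Finset.mul_sum]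
      _ = ∑ μ, ∑ z ∈ box (fun i => n * N i), conj (φ z) * (2 * φ z - φ (z + e μ) - φ (z - e μ)) :=
          Finset.sum_comm
      _ = ∑ μ, ∑ z ∈ box (fun i => n * N i), ((‖φ (z + e μ) - φ z‖ : ℝ) : ℂ) ^ 2 :=
          Finset.sum_congr rfl fun μ _ => grad_term hP hφ μ
      _ = _ := Finset.sum_comm
  have hmass : ∑ z ∈ box (fun i => n * N i), conj (φ z) * φ z
      = ∑ z ∈ box (fun i => n * N i), ((‖φ z‖ : ℝ) : ℂ) ^ 2 :=
    Finset.sum_congr rfl fun z _ => Complex.conj_mul' _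
  have hblock : ∑ z ∈ box (fun i => n * N i), conj (φ z) * ∑ j : Fin (d + 1) → Fin n, φ (finePt n (coarse n z) j)
      = ∑ x ∈ box N, ((‖∑ j : Fin (d + 1) → Fin n, φ (finePt n x j)‖ : ℝ) : ℂ) ^ 2 := by
    rw [sum_box_fine n N]
    refine Finset.sum_congr rfl fun x _ => ?_
    simp_rw [coarse_finePt]
    rw [← Finset.sum_mul, ← map_sum, Complex.conj_mul']
  -- assembly
  push_cast
  calc ∑ z ∈ box (fun i => n * N i), conj (φ z) * opD n a m2 φ z
      = ∑ z ∈ box (fun i => n * N i), ((n : ℂ) ^ 2 * (conj (φ z) * ∑ μ, (2 * φ z - φ (z + e μ) - φ (z - e μ)))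
          + (m2 : ℂ) * (conj (φ z) * φ z)
          + (a : ℂ) * ((n : ℂ) ^ (d + 1))⁻¹
              * (conj (φ z) * ∑ j : Fin (d + 1) → Fin n, φ (finePt n (coarse n z) j))) :=
        Finset.sum_congr rfl fun z _ => by simp only [opD, negLap, blockAvg]; ring
    _ = (n : ℂ) ^ 2 * ∑ z ∈ box (fun i => n * N i), conj (φ z) * ∑ μ, (2 * φ z - φ (z + e μ) - φ (z - e μ))
          + (m2 : ℂ) * ∑ z ∈ box (fun i => n * N i), conj (φ z) * φ z
          + (a : ℂ) * ((n : ℂ) ^ (d + 1))⁻¹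
              * ∑ z ∈ box (fun i => n * N i), conj (φ z) * ∑ j : Fin (d + 1) → Fin n, φ (finePt n (coarse n z) j) := by
        rw [Finset.sum_add_distrib, Finset.sum_add_distrib, Finset.mul_sum, Finset.mul_sum, Finset.mul_sum]
    _ = _ := by rw [hgrad, hmass, hblock]

/-! ### §4 Positivity ⇒ injectivity of `D` on the torus; uniqueness of the torus Green kernel -/

/-- a function on `ℤ^{d+1}` invariant under every unit shift is constant. [folklore] -/
theorem constant_of_shift_invariant {φ : (Fin (d + 1) → ℤ) → ℂ} (h : ∀ z μ, φ (z + e μ) = φ z)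
    (z : Fin (d + 1) → ℤ) : φ z = φ 0 := by
  have h1 : ∀ (μ : Fin (d + 1)) (t : ℤ) (w : Fin (d + 1) → ℤ), φ (w + t • e μ) = φ w := by
    intro μ t
    induction t with
    | zero => intro w; rw [zero_smul, add_zero]
    | succ k ih => intro w; rw [add_smul, one_smul, ← add_assoc, h, ih]
    | pred k ih =>
        intro w
        have hu := h (w + (-(k : ℤ) - 1) • e μ) μ
        rw [add_assoc, show (-(k : ℤ) - 1) • e μ + e μ = (-(k : ℤ)) • e μ by
          rw [sub_smul, one_smul, sub_add_cancel]] at hu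
        rw [← hu, ih]
  have h2 : ∀ (s : Finset (Fin (d + 1))) (w : Fin (d + 1) → ℤ), φ (w + ∑ μ ∈ s, z μ • e μ) = φ w := by
    intro s
    induction s using Finset.induction_on with
    | empty => intro w; rw [Finset.sum_empty, add_zero]
    | insert μ s hμ ih => intro w; rw [Finset.sum_insert hμ, ← add_assoc, ih, h1]
  have hz : z = 0 + ∑ μ, z μ • e μ := by
    rw [zero_add]
    funext i
    simp [Finset.sum_apply, e, Pi.single_apply]
  rw [hz]
  exact h2 Finset.univ 0

/-- **INJECTIVITY OF `D = −Δ^ξ + m² + aQ^*Q` ON THE TORUS** (`a > 0`, `m² ≥ 0`): a `(nN_μ)_μ`-periodic `φ` with `Dφ = 0`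
vanishes — by `energy_identity` the gradient and block terms vanish, so `φ` is constant with zero block sums.  The torus
form of `0 < G_k` of (2.28). [cite: Balaban1983RegularityDecay, (2.27)–(2.28) p.580, (1.6) p.572; dictionary (torus,
A = 0, qualitative); proof supplied by the audit] -/
theorem opD_torus_injective (n : ℕ) [NeZero n] (a m2 : ℝ) (ha : 0 < a) (hm : 0 ≤ m2) {N : Fin (d + 1) → ℕ}
    (hN : ∀ i, 1 ≤ N i) (φ : (Fin (d + 1) → ℤ) → ℂ) (hφ : IsPeriodic (fun i => n * N i) φ)
    (h0 : ∀ z, opD n a m2 φ z = 0) : φ = 0 := by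
  have hP := period_pos n hN
  have hE := energy_identity n a m2 hN φ hφ
  simp only [h0, mul_zero, Finset.sum_const_zero] at hE
  have hE' := (Complex.ofReal_eq_zero.mp hE.symm)
  -- the three nonnegative parts
  set Gr := ∑ z ∈ box (fun i => n * N i), ∑ μ, ‖φ (z + e μ) - φ z‖ ^ 2 with hGr
  set Mr := ∑ z ∈ box (fun i => n * N i), ‖φ z‖ ^ 2 with hMr
  set Br := ∑ x ∈ box N, ‖∑ j : Fin (d + 1) → Fin n, φ (finePt n x j)‖ ^ 2 with hBr
  have hGr0 : 0 ≤ Gr := Finset.sum_nonneg fun z _ => Finset.sum_nonneg fun μ _ => sq_nonneg _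
  have hMr0 : 0 ≤ Mr := Finset.sum_nonneg fun z _ => sq_nonneg _
  have hBr0 : 0 ≤ Br := Finset.sum_nonneg fun x _ => sq_nonneg _
  have hn2 : (0 : ℝ) < (n : ℝ) ^ 2 := by
    have : (0 : ℝ) < n := by exact_mod_cast Nat.pos_of_ne_zero (NeZero.ne n)
    positivity
  have hc : (0 : ℝ) < ((n : ℝ) ^ (d + 1))⁻¹ := by
    have : (0 : ℝ) < n := by exact_mod_cast Nat.pos_of_ne_zero (NeZero.ne n)
    positivity
  have hG : Gr = 0 := by
    have h1 : (n : ℝ) ^ 2 * Gr ≤ 0 := by nlinarith [mul_nonneg hm hMr0, mul_nonneg (mul_nonneg ha.le hc.le) hBr0]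
    have h2 : (n : ℝ) ^ 2 * Gr = 0 := le_antisymm h1 (mul_nonneg hn2.le hGr0)
    exact (mul_eq_zero.mp h2).resolve_left hn2.ne'
  have hB : Br = 0 := by
    have h1 : a * ((n : ℝ) ^ (d + 1))⁻¹ * Br ≤ 0 := by nlinarith [mul_nonneg hm hMr0, mul_nonneg hn2.le hGr0]
    have h2 : a * ((n : ℝ) ^ (d + 1))⁻¹ * Br = 0 := le_antisymm h1 (mul_nonneg (mul_nonneg ha.le hc.le) hBr0)
    exact (mul_eq_zero.mp h2).resolve_left (mul_ne_zero ha.ne' hc.ne')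
  -- gradient term zero ⇒ shift invariance (first on the box, then everywhere by periodicity)
  have key : ∀ w ∈ box (fun i => n * N i), ∀ μ, φ (w + e μ) = φ w := by
    intro w hw μ
    have h1 := (Finset.sum_eq_zero_iff_of_nonneg fun w _ => Finset.sum_nonneg fun μ _ => sq_nonneg _).mp hG w hw
    have h2 := (Finset.sum_eq_zero_iff_of_nonneg fun μ _ => sq_nonneg _).mp h1 μ (Finset.mem_univ _)
    exact sub_eq_zero.mp (norm_eq_zero.mp ((pow_eq_zero_iff two_ne_zero).mp h2))
  have hshift : ∀ z μ, φ (z + e μ) = φ z := by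
    intro z μ
    have hz : z = MultiPeriod.translate (fun i => n * N i) (wrap (fun i => n * N i) z)
        (fun i => z i / ((n * N i : ℕ) : ℤ)) := by
      funext i
      rw [MultiPeriod.translate_apply]
      show z i = z i % ((n * N i : ℕ) : ℤ) + ((n * N i : ℕ) : ℤ) * (z i / ((n * N i : ℕ) : ℤ))
      linarith [Int.mul_ediv_add_emod (z i) ((n * N i : ℕ) : ℤ)]
    calc φ (z + e μ)
        = φ (MultiPeriod.translate (fun i => n * N i) (wrap (fun i => n * N i) z + e μ)
            (fun i => z i / ((n * N i : ℕ) : ℤ))) := by rw [← translate_add_right, ← hz]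
      _ = φ (wrap (fun i => n * N i) z + e μ) := hφ _ _
      _ = φ (wrap (fun i => n * N i) z) := key _ (wrap_mem_box hP z) μ
      _ = φ z := hφ.wrap_eq z
  have hconst : ∀ z, φ z = φ 0 := constant_of_shift_invariant hshift
  -- block term zero at the block of the origin ⇒ the constant vanishes
  have h0box : (0 : Fin (d + 1) → ℤ) ∈ box N :=
    mem_box.mpr fun i => ⟨le_rfl, by have := hN i; simp only [Pi.zero_apply]; omega⟩
  have hsum : ∑ j : Fin (d + 1) → Fin n, φ (finePt n 0 j) = 0 :=
    norm_eq_zero.mp ((pow_eq_zero_iff two_ne_zero).mp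
      ((Finset.sum_eq_zero_iff_of_nonneg fun x _ => sq_nonneg _).mp hB 0 h0box))
  have hcard : ∑ j : Fin (d + 1) → Fin n, φ (finePt n 0 j) = (Fintype.card (Fin (d + 1) → Fin n) : ℂ) * φ 0 := by
    rw [Finset.sum_congr rfl fun j _ => hconst (finePt n 0 j), Finset.sum_const, Finset.card_univ, nsmul_eq_mul]
  have hne : (Fintype.card (Fin (d + 1) → Fin n) : ℂ) ≠ 0 := by
    rw [Fintype.card_fun, Fintype.card_fin, Fintype.card_fin]
    exact_mod_cast pow_ne_zero _ (NeZero.ne n)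
  have hφ0 : φ 0 = 0 := by
    rw [hcard] at hsum
    exact (mul_eq_zero.mp hsum).resolve_left hne
  funext z
  rw [hconst z, hφ0]
  rfl

/-- `D` is additive. [folklore] -/
theorem opD_add (n : ℕ) (a m2 : ℝ) (φ ψ : (Fin (d + 1) → ℤ) → ℂ) (z : Fin (d + 1) → ℤ) :
    opD n a m2 (φ + ψ) z = opD n a m2 φ z + opD n a m2 ψ z := by
  simp only [opD_eq_stencil, Pi.add_apply, mul_add, Finset.sum_add_distrib]

/-- `D` commutes with scalars. [folklore] -/
theorem opD_smul (n : ℕ) (a m2 : ℝ) (c : ℂ) (φ : (Fin (d + 1) → ℤ) → ℂ) (z : Fin (d + 1) → ℤ) :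
    opD n a m2 (c • φ) z = c * opD n a m2 φ z := by
  simp only [opD_eq_stencil, Pi.smul_apply, smul_eq_mul, Finset.mul_sum]
  exact Finset.sum_congr rfl fun i _ => by ring

/-- `D` respects differences. [folklore] -/
theorem opD_sub (n : ℕ) (a m2 : ℝ) (φ ψ : (Fin (d + 1) → ℤ) → ℂ) (z : Fin (d + 1) → ℤ) :
    opD n a m2 (φ - ψ) z = opD n a m2 φ z - opD n a m2 ψ z := by
  simp only [opD_eq_stencil, Pi.sub_apply, mul_sub, Finset.sum_sub_distrib]

/-- **UNIQUENESS OF THE TORUS GREEN KERNEL** (closes HONEST SCOPE (ii) of `B4TorusGreen244`): every `(nN_μ)_μ`-periodic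
`ψ` with `Dψ = 1[⌊·/n⌋ ≡ y mod N]` (= `Q_j^*δ^T_y`) IS `K_T(·,y)` — the finite dual-grid kernel `torusKernel248` of (2.48)
is THE kernel of `G_jQ_j^*` on the torus `Π_μ ℤ/(nN_μ)`. [cite: Balaban1983RegularityDecay, (2.44)–(2.48) p.584–585 with
(1.6) p.572 (torus); proof supplied by the audit] -/
theorem torusGreen244_unique (n : ℕ) [NeZero n] (hn : 1 ≤ n) (a m2 : ℝ) (ha : 0 < a) (hm : 0 ≤ m2)
    {N : Fin (d + 1) → ℕ} (hN : ∀ i, 1 ≤ N i) (y : Fin (d + 1) → ℤ) (ψ : (Fin (d + 1) → ℤ) → ℂ)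
    (hψ : IsPeriodic (fun i => n * N i) ψ)
    (hDψ : ∀ z, opD n a m2 ψ z = if ∀ i, (N i : ℤ) ∣ coarse n z i - y i then 1 else 0) :
    ψ = fun z => KT n a m2 N z y := by
  have hper : IsPeriodic (fun i => n * N i) (ψ - fun z => KT n a m2 N z y) := fun z m => by
    simp only [Pi.sub_apply]
    rw [hψ z m, KT_translate_left n a m2 hN]
  have h0 : ∀ z, opD n a m2 (ψ - fun z => KT n a m2 N z y) z = 0 := fun z => by
    rw [opD_sub, hDψ, torusGreen244 n hn a m2 ha hm hN, sub_self]
  exact sub_eq_zero.mp (opD_torus_injective n a m2 ha hm hN _ hper h0)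

/-! ### §5 Invertibility: the Green operator `G_j = D⁻¹` of (1.6) exists on the torus -/

/-- reduction modulo the period forgets period translates. [folklore] -/
theorem wrap_translate (P : Fin (d + 1) → ℕ) (z m : Fin (d + 1) → ℤ) :
    wrap P (MultiPeriod.translate P z m) = wrap P z := by
  funext i
  simp only [wrap, MultiPeriod.translate_apply]
  exact Int.add_mul_emod_self_left _ _ _

/-- two `P`-periodic functions agreeing on the period box agree everywhere. [folklore] -/
theorem IsPeriodic.ext_box {P : Fin (d + 1) → ℕ} (hP : ∀ i, 1 ≤ P i) {φ ψ : (Fin (d + 1) → ℤ) → ℂ}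
    (hφ : IsPeriodic P φ) (hψ : IsPeriodic P ψ) (h : ∀ z ∈ box P, φ z = ψ z) : φ = ψ := by
  funext z
  rw [← hφ.wrap_eq z, ← hψ.wrap_eq z]
  exact h _ (wrap_mem_box hP z)

/-- `D` maps `(nN_μ)_μ`-periodic functions to `(nN_μ)_μ`-periodic functions (`B4TorusGreen244.opD_translate`): it IS an
operator on the torus `Π_μ ℤ/(nN_μ)`. [cite: Balaban1983RegularityDecay, (1.6) p.572 (torus); dictionary] -/
theorem IsPeriodic.opD (n : ℕ) [NeZero n] (a m2 : ℝ) {N : Fin (d + 1) → ℕ} {φ : (Fin (d + 1) → ℤ) → ℂ}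
    (hφ : IsPeriodic (fun i => n * N i) φ) : IsPeriodic (fun i => n * N i) (opD n a m2 φ) := fun z m =>
  opD_translate n a m2 N φ hφ z m

/-- periodic extension of a function on the period box to `ℤ^{d+1}`. [folklore] -/
def pext (P : Fin (d + 1) → ℕ) (hP : ∀ i, 1 ≤ P i) (g : box P → ℂ) : (Fin (d + 1) → ℤ) → ℂ :=
  fun w => g ⟨wrap P w, wrap_mem_box hP w⟩

/-- the periodic extension is periodic. [folklore] -/
theorem pext_periodic {P : Fin (d + 1) → ℕ} (hP : ∀ i, 1 ≤ P i) (g : box P → ℂ) : IsPeriodic P (pext P hP g) :=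
  fun z m => by
    simp only [pext]
    exact congrArg g (Subtype.ext (wrap_translate P z m))

/-- the periodic extension restricts back to the given function on the box. [folklore] -/
theorem pext_apply_of_mem {P : Fin (d + 1) → ℕ} (hP : ∀ i, 1 ≤ P i) (g : box P → ℂ) {z : Fin (d + 1) → ℤ}
    (hz : z ∈ box P) : pext P hP g z = g ⟨z, hz⟩ := by
  simp only [pext]
  exact congrArg g (Subtype.ext (wrap_eq_self_of_mem hz))

/-- the periodic extension is additive. [folklore] -/
theorem pext_add {P : Fin (d + 1) → ℕ} (hP : ∀ i, 1 ≤ P i) (g₁ g₂ : box P → ℂ) :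
    pext P hP (g₁ + g₂) = pext P hP g₁ + pext P hP g₂ := rfl

/-- the periodic extension commutes with scalars. [folklore] -/
theorem pext_smul {P : Fin (d + 1) → ℕ} (hP : ∀ i, 1 ≤ P i) (c : ℂ) (g : box P → ℂ) :
    pext P hP (c • g) = c • pext P hP g := rfl

/-- `D = −Δ^ξ + m² + aQ^*Q` ON THE TORUS as a `ℂ`-linear endomorphism of the functions on one period box `Π_μ [0, nN_μ)`
(a function on the box ↦ its periodic extension ↦ `D` of it, read on the box): the operator (1.6), A = 0, on
`T_ξ = Π_μ ℤ/(nN_μ)` in coordinates. [cite: Balaban1983RegularityDecay, (1.6) p.572 (torus); dictionary] -/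
def opDBox (n : ℕ) [NeZero n] (a m2 : ℝ) (N : Fin (d + 1) → ℕ) (hN : ∀ i, 1 ≤ N i) :
    (box (fun i => n * N i) → ℂ) →ₗ[ℂ] (box (fun i => n * N i) → ℂ) where
  toFun g z := opD n a m2 (pext (fun i => n * N i) (period_pos n hN) g) z.1
  map_add' g₁ g₂ := by
    funext z
    show opD n a m2 (pext _ (period_pos n hN) (g₁ + g₂)) z.1
      = opD n a m2 (pext _ (period_pos n hN) g₁) z.1 + opD n a m2 (pext _ (period_pos n hN) g₂) z.1
    rw [pext_add, opD_add]
  map_smul' c g := by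
    funext z
    show opD n a m2 (pext _ (period_pos n hN) (c • g)) z.1 = c * opD n a m2 (pext _ (period_pos n hN) g) z.1
    rw [pext_smul, opD_smul]

/-- the value of `opDBox`. [folklore] -/
theorem opDBox_apply (n : ℕ) [NeZero n] (a m2 : ℝ) {N : Fin (d + 1) → ℕ} (hN : ∀ i, 1 ≤ N i)
    (g : box (fun i => n * N i) → ℂ) (z : box (fun i => n * N i)) :
    opDBox n a m2 N hN g z = opD n a m2 (pext (fun i => n * N i) (period_pos n hN) g) z.1 := rfl

/-- **`D` IS A BIJECTION ON THE TORUS** (`a > 0`, `m² ≥ 0`): injective by `opD_torus_injective`, hence surjective — the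
function space of the finite torus is finite-dimensional. [cite: Balaban1983RegularityDecay, (1.6) p.572 (the inverse
`G_k(Ω,A) = (…)^{−1}`, torus case); proof supplied by the audit] -/
theorem opDBox_bijective (n : ℕ) [NeZero n] (a m2 : ℝ) (ha : 0 < a) (hm : 0 ≤ m2) {N : Fin (d + 1) → ℕ}
    (hN : ∀ i, 1 ≤ N i) : Function.Bijective (opDBox n a m2 N hN) := by
  have hP := period_pos n hN
  have hinj : Function.Injective (opDBox n a m2 N hN) := by
    refine (injective_iff_map_eq_zero _).mpr fun g hg => ?_
    have hper := pext_periodic hP g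
    -- `D(pext g)` vanishes on the box, hence everywhere (it is periodic)
    have hbox : ∀ z ∈ box (fun i => n * N i), opD n a m2 (pext _ hP g) z = (0 : (Fin (d + 1) → ℤ) → ℂ) z :=
      fun z hz => by
        have h := congrFun hg ⟨z, hz⟩
        rw [opDBox_apply] at h
        exact h
    have h0 := IsPeriodic.ext_box hP (hper.opD n a m2) (fun _ _ => rfl) hbox
    have hzero := opD_torus_injective n a m2 ha hm hN _ hper (fun z => congrFun h0 z)
    funext z
    have hz := congrFun hzero z.1
    rw [pext_apply_of_mem hP g z.2] at hz
    exact hz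
  exact ⟨hinj, LinearMap.injective_iff_surjective.mp hinj⟩

/-- **THE GREEN OPERATOR EXISTS ON THE TORUS**: for every `(nN_μ)_μ`-periodic `f` there is exactly one `(nN_μ)_μ`-periodic
`φ` with `(−Δ^ξ + m² + aQ^*Q)φ = f` — `φ = G_j f`, the operator (1.6) (A = 0) on `T_ξ = Π_μ ℤ/(nN_μ)`, any `n ≥ 1`, `a > 0`,
`m² ≥ 0` (including `m = 0`: the zero mode of the torus Laplacian is removed by `aQ^*Q`). [cite: Balaban1983RegularityDecay,
(1.6) p.572, (2.44) p.584 ("Defining the propagator G_j, φ₀ = G_jf"); dictionary (torus); proof supplied by the audit] -/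
theorem torusGreen_existsUnique (n : ℕ) [NeZero n] (a m2 : ℝ) (ha : 0 < a) (hm : 0 ≤ m2) {N : Fin (d + 1) → ℕ}
    (hN : ∀ i, 1 ≤ N i) (f : (Fin (d + 1) → ℤ) → ℂ) (hf : IsPeriodic (fun i => n * N i) f) :
    ∃! φ : (Fin (d + 1) → ℤ) → ℂ, IsPeriodic (fun i => n * N i) φ ∧ ∀ z, opD n a m2 φ z = f z := by
  have hP := period_pos n hN
  obtain ⟨g, hg⟩ := (opDBox_bijective n a m2 ha hm hN).2 fun z => f z.1
  have hper := pext_periodic hP g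
  have hsol : opD n a m2 (pext _ hP g) = f :=
    IsPeriodic.ext_box hP (hper.opD n a m2) hf fun z hz => by
      have h := congrFun hg ⟨z, hz⟩
      rw [opDBox_apply] at h
      exact h
  refine ⟨pext _ hP g, ⟨hper, fun z => congrFun hsol z⟩, fun ψ hψ => ?_⟩
  -- uniqueness: `D(ψ − pext g) = 0` with `ψ − pext g` periodic
  have hdper : IsPeriodic (fun i => n * N i) (ψ - pext _ hP g) := fun z m => by
    simp only [Pi.sub_apply]
    rw [hψ.1 z m, hper z m]
  have h0 : ∀ z, opD n a m2 (ψ - pext _ hP g) z = 0 := fun z => by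
    rw [opD_sub, hψ.2 z, congrFun hsol z, sub_self]
  exact sub_eq_zero.mp (opD_torus_injective n a m2 ha hm hN _ hdper h0)

end

end Literature.MathematicalPhysics.QuantumFieldTheory.Balaban1983to89.B4TorusPositivity
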